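import Summits.Parity.GeneralizedHardyLittlewood.Theorems.PrimeLevelFamEdgeMomentsBeyondDiagonalQuantifiers
import HarnessLib

/-!
# Route `PrimeLevelFamEdge`, crux K_A `MomentsBeyondDiagonal` (stmt-Parity-20007), line «petersson_layers» v3:
# REFUTATION SHAPES for the pieces and for the crux (lead prover, 2026-08-28; continues
# `PrimeLevelFamEdgeMomentsBeyondDiagonalQuantifiers`, §§1–4)

By the quantifier ledger (§1 pointwise form, §2 subsequence rigidity), `¬ SubOf F` for a level family `F` of the
line is witnessed, on each window, at a SINGLE `(Δ', P, Q)` by EITHER two distinct constants fitting `F` within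
`C q̂ log⁻³ q̂` along two unbounded sets of good primes (oscillation of the normalised piece
`F/(2ζ(2)² q̂/(Δ'² log² q̂))`) OR unboundedness of the normalised piece. These are the «Targets» shapes the crux's
disprover needs for the stuck stubs `stub_core : SubUpper rhoCore`, `stub_rung : SubRung`,
`stub_band : SubBand rhoCore rhoP`; and since K_A's second display is itself a `HasShape` statement
(`hasShape_QhPQ_of_momentAsymptotics`), the same two shapes — at `Δ'` arbitrarily close to `1` — refute
`MomentsBeyondDiagonal`. TOOLS ONLY: every theorem here is an implication from an explicitly displayed
witness hypothesis; no witness is claimed or known (in the route's (A)-world heuristic the resonant Petersson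
layers `r ∈ Dℕ` would supply an oscillation witness — a heuristic, not a theorem).

HONESTY. No moment asymptotic, no piece of K_A, no refutation of K_A and no exceptional-zero statement (no
Landau–Siegel / Siegel-zero exclusion, no GRH) is proved or claimed here; famE-02 (the second mollified moment
beyond the diagonal at an individual prime level) remains OPEN IN PRINT.
-/

noncomputable section

open scoped Real
open Complex Polynomial
open Literature.NumberTheory.LFunctions

namespace Summit.Parity.GeneralizedHardyLittlewood.Theorems.PrimeLevelFamEdgeIdeaDeltas.PeterssonLayers

open Summit.Parity.GeneralizedHardyLittlewood.Theses.PrimeLevelFamEdge (MomentsBeyondDiagonal)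

/-! ## §5. Refutation shapes: what a disproof of a piece (or of K_A) must exhibit -/

/-- **TWO LIMITS KILL THE SHAPE.** If at some `(Δ', P, Q)` of the window two DISTINCT constants `t' ≠ t''` each fit
`F` within `C q̂ log⁻³ q̂` along unbounded sets of good primes, then no functional gives `F` the second-display
shape on any window containing `Δ'`. -/
theorem not_hasShape_of_two_fits {F : LevelFamily} {Δ : ℝ} {P Q : ℝ[X]} (hP : KMV2000.Admissible P)
    (hQ : KMV2000.IsEvenOrOdd Q) {Δ' : ℝ} (h1 : 1 < Δ') (h2 : Δ' ≤ Δ) {t' t'' C' C'' : ℝ} (hne : t' ≠ t'')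
    (hio' : ∀ q₀ : ℕ, ∃ q : ℕ, ∃ _ : NeZero q, q.Prime ∧ q₀ ≤ q ∧
      (∀ n : ℕ, (n : ℝ) ≠ KMV2000.qhat q ^ Δ') ∧
        ‖F q P Q Δ' -
            ((2 * riemannZeta 2 ^ 2 *
                ((KMV2000.qhat q / (Δ' ^ 2 * Real.log (KMV2000.qhat q) ^ 2) : ℝ) : ℂ)) *
              ((t' : ℝ) : ℂ))‖ ≤
          C' * KMV2000.qhat q * (Real.log (KMV2000.qhat q))⁻¹ ^ 3)
    (hio'' : ∀ q₀ : ℕ, ∃ q : ℕ, ∃ _ : NeZero q, q.Prime ∧ q₀ ≤ q ∧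
      (∀ n : ℕ, (n : ℝ) ≠ KMV2000.qhat q ^ Δ') ∧
        ‖F q P Q Δ' -
            ((2 * riemannZeta 2 ^ 2 *
                ((KMV2000.qhat q / (Δ' ^ 2 * Real.log (KMV2000.qhat q) ^ 2) : ℝ) : ℂ)) *
              ((t'' : ℝ) : ℂ))‖ ≤
          C'' * KMV2000.qhat q * (Real.log (KMV2000.qhat q))⁻¹ ^ 3)
    (t : ℝ → ℝ[X] → ℝ[X] → ℝ) : ¬ HasShape F Δ t := by
  intro h
  have e' : t' = t Δ' P Q := hasShape_eq_of_frequently h hP hQ h1 h2 hio'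
  have e'' : t'' = t Δ' P Q := hasShape_eq_of_frequently h hP hQ h1 h2 hio''
  exact hne (e'.trans e''.symm)

/-- **OSCILLATION ON EVERY WINDOW KILLS THE PIECE.** If for every `Δ₁ > 1` some `(Δ', P, Q)` with `Δ' ∈ (1, Δ₁]`
carries two distinct fitting constants as in `not_hasShape_of_two_fits`, then `¬ SubOf F`. -/
theorem not_subOf_of_two_fits {F : LevelFamily}
    (H : ∀ Δ₁ : ℝ, 1 < Δ₁ → ∃ Δ' : ℝ, 1 < Δ' ∧ Δ' ≤ Δ₁ ∧ ∃ P Q : ℝ[X], KMV2000.Admissible P ∧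
      KMV2000.IsEvenOrOdd Q ∧ ∃ t' t'' C' C'' : ℝ, t' ≠ t'' ∧
        (∀ q₀ : ℕ, ∃ q : ℕ, ∃ _ : NeZero q, q.Prime ∧ q₀ ≤ q ∧
          (∀ n : ℕ, (n : ℝ) ≠ KMV2000.qhat q ^ Δ') ∧
            ‖F q P Q Δ' -
                ((2 * riemannZeta 2 ^ 2 *
                    ((KMV2000.qhat q / (Δ' ^ 2 * Real.log (KMV2000.qhat q) ^ 2) : ℝ) : ℂ)) *
                  ((t' : ℝ) : ℂ))‖ ≤
              C' * KMV2000.qhat q * (Real.log (KMV2000.qhat q))⁻¹ ^ 3) ∧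
        (∀ q₀ : ℕ, ∃ q : ℕ, ∃ _ : NeZero q, q.Prime ∧ q₀ ≤ q ∧
          (∀ n : ℕ, (n : ℝ) ≠ KMV2000.qhat q ^ Δ') ∧
            ‖F q P Q Δ' -
                ((2 * riemannZeta 2 ^ 2 *
                    ((KMV2000.qhat q / (Δ' ^ 2 * Real.log (KMV2000.qhat q) ^ 2) : ℝ) : ℂ)) *
                  ((t'' : ℝ) : ℂ))‖ ≤
              C'' * KMV2000.qhat q * (Real.log (KMV2000.qhat q))⁻¹ ^ 3)) :
    ¬ SubOf F := by
  rintro ⟨Δ, hΔ, t, h⟩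
  obtain ⟨Δ', h1, h2, P, Q, hP, hQ, t', t'', C', C'', hne, hio', hio''⟩ := H Δ hΔ
  exact not_hasShape_of_two_fits hP hQ h1 h2 hne hio' hio'' t h

/-- **A BOUND THE SHAPE FORCES.** If `F` has the shape with functional `t`, then at each `(Δ', P, Q)` of the window
the normalised piece is eventually bounded: `‖F‖ ≤ (‖2ζ(2)²‖·|t Δ' P Q| + |C|·Δ'²)·q̂/(Δ'² log² q̂)` for all
good primes `q ≥ q₀` with `log q̂ ≥ 1`. -/
theorem hasShape_bound {F : LevelFamily} {Δ : ℝ} {t : ℝ → ℝ[X] → ℝ[X] → ℝ} (h : HasShape F Δ t)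
    {P Q : ℝ[X]} (hP : KMV2000.Admissible P) (hQ : KMV2000.IsEvenOrOdd Q) {Δ' : ℝ} (h1 : 1 < Δ')
    (h2 : Δ' ≤ Δ) :
    ∃ K : ℝ, ∃ q₀ : ℕ, ∀ (q : ℕ) [NeZero q], q.Prime → q₀ ≤ q → (∀ n : ℕ, (n : ℝ) ≠ KMV2000.qhat q ^ Δ') →
      ‖F q P Q Δ'‖ ≤ K * (KMV2000.qhat q / (Δ' ^ 2 * Real.log (KMV2000.qhat q) ^ 2)) := by
  obtain ⟨C, q₀, hC⟩ := h P Q hP hQ Δ' h1 h2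
  have hΔ'pos : 0 < Δ' := zero_lt_one.trans h1
  obtain ⟨N, hN⟩ := KMV2000.exists_log_qhat_ge 1
  refine ⟨‖(2 * riemannZeta 2 ^ 2 : ℂ)‖ * |t Δ' P Q| + |C| * Δ' ^ 2, max q₀ N, fun q _ hq hq₀ hn ↦ ?_⟩
  have hlg : 1 ≤ Real.log (KMV2000.qhat q) := hN q (le_trans (le_max_right _ _) hq₀)
  have hlgpos : 0 < Real.log (KMV2000.qhat q) := by linarith
  have hqhatpos : 0 < KMV2000.qhat q := by
    unfold KMV2000.qhat
    have : 0 < (q : ℝ) := by exact_mod_cast hq.pos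
    positivity
  set r : ℝ := KMV2000.qhat q / (Δ' ^ 2 * Real.log (KMV2000.qhat q) ^ 2) with hr
  have hrpos : 0 < r := by rw [hr]; positivity
  set A : ℂ := 2 * riemannZeta 2 ^ 2 * ((r : ℝ) : ℂ) * ((t Δ' P Q : ℝ) : ℂ) with hA
  have b1 := hC q hq (le_trans (le_max_left _ _) hq₀) hn
  have hnA : ‖A‖ = ‖(2 * riemannZeta 2 ^ 2 : ℂ)‖ * |t Δ' P Q| * r := by
    rw [hA, norm_mul, norm_mul, Complex.norm_real, Complex.norm_real, Real.norm_eq_abs, Real.norm_eq_abs,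
      abs_of_pos hrpos]
    ring
  have herr : C * KMV2000.qhat q * (Real.log (KMV2000.qhat q))⁻¹ ^ 3 ≤ |C| * Δ' ^ 2 * r := by
    have hs2 : 0 ≤ KMV2000.qhat q * (Real.log (KMV2000.qhat q))⁻¹ ^ 3 := by positivity
    calc C * KMV2000.qhat q * (Real.log (KMV2000.qhat q))⁻¹ ^ 3
        ≤ |C| * KMV2000.qhat q * (Real.log (KMV2000.qhat q))⁻¹ ^ 3 := by
          rw [mul_assoc, mul_assoc]
          exact mul_le_mul_of_nonneg_right (le_abs_self C) hs2
      _ = (|C| * Δ' ^ 2 * r) * (Real.log (KMV2000.qhat q))⁻¹ := by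
          rw [hr]
          field_simp
      _ ≤ (|C| * Δ' ^ 2 * r) * 1 := by
          refine mul_le_mul_of_nonneg_left ?_ (by positivity)
          exact inv_le_one_of_one_le₀ hlg
      _ = |C| * Δ' ^ 2 * r := mul_one _
  calc ‖F q P Q Δ'‖ = ‖(F q P Q Δ' - A) + A‖ := by rw [sub_add_cancel]
    _ ≤ ‖F q P Q Δ' - A‖ + ‖A‖ := norm_add_le _ _
    _ ≤ |C| * Δ' ^ 2 * r + ‖(2 * riemannZeta 2 ^ 2 : ℂ)‖ * |t Δ' P Q| * r := by
        rw [hnA]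
        exact add_le_add (b1.trans herr) le_rfl
    _ = (‖(2 * riemannZeta 2 ^ 2 : ℂ)‖ * |t Δ' P Q| + |C| * Δ' ^ 2) * r := by ring

/-- **UNBOUNDEDNESS KILLS THE SHAPE.** If at some `(Δ', P, Q)` of the window the normalised piece
`F/(q̂/(Δ'² log² q̂))` is unbounded along the good primes, then no functional gives `F` the shape on any
window containing `Δ'`. -/
theorem not_hasShape_of_unbounded {F : LevelFamily} {Δ : ℝ} {P Q : ℝ[X]} (hP : KMV2000.Admissible P)
    (hQ : KMV2000.IsEvenOrOdd Q) {Δ' : ℝ} (h1 : 1 < Δ') (h2 : Δ' ≤ Δ)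
    (hub : ∀ K : ℝ, ∀ q₀ : ℕ, ∃ q : ℕ, ∃ _ : NeZero q, q.Prime ∧ q₀ ≤ q ∧
      (∀ n : ℕ, (n : ℝ) ≠ KMV2000.qhat q ^ Δ') ∧
        K * (KMV2000.qhat q / (Δ' ^ 2 * Real.log (KMV2000.qhat q) ^ 2)) < ‖F q P Q Δ'‖)
    (t : ℝ → ℝ[X] → ℝ[X] → ℝ) : ¬ HasShape F Δ t := by
  intro h
  obtain ⟨K, q₀, hK⟩ := hasShape_bound h hP hQ h1 h2
  obtain ⟨q, inst, hq, hqge, hgood, hlt⟩ := hub K q₀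
  exact (lt_irrefl _) (hlt.trans_le (hK q hq hqge hgood))

/-- **UNBOUNDEDNESS ON EVERY WINDOW KILLS THE PIECE.** -/
theorem not_subOf_of_unbounded {F : LevelFamily}
    (H : ∀ Δ₁ : ℝ, 1 < Δ₁ → ∃ Δ' : ℝ, 1 < Δ' ∧ Δ' ≤ Δ₁ ∧ ∃ P Q : ℝ[X], KMV2000.Admissible P ∧
      KMV2000.IsEvenOrOdd Q ∧ ∀ K : ℝ, ∀ q₀ : ℕ, ∃ q : ℕ, ∃ _ : NeZero q, q.Prime ∧ q₀ ≤ q ∧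
        (∀ n : ℕ, (n : ℝ) ≠ KMV2000.qhat q ^ Δ') ∧
          K * (KMV2000.qhat q / (Δ' ^ 2 * Real.log (KMV2000.qhat q) ^ 2)) < ‖F q P Q Δ'‖) :
    ¬ SubOf F := by
  rintro ⟨Δ, hΔ, t, h⟩
  obtain ⟨Δ', h1, h2, P, Q, hP, hQ, hub⟩ := H Δ hΔ
  exact not_hasShape_of_unbounded hP hQ h1 h2 hub t h

/-- **K_A's second display IS a `HasShape` statement** for the level family `q ↦ Q^h(P,Q)(q̂^{Δ'})` with functional
`secondMomentForm + T₂` (window `(1, Δ]`): so §2 and §5 apply verbatim to the crux — its `T₂` is the limit of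
the normalised second moment along the good primes, and two limits / unboundedness at `(Δ', P, Q)` with `Δ'`
arbitrarily close to `1` refute `MomentsBeyondDiagonal`. -/
theorem hasShape_QhPQ_of_momentAsymptotics {Δ : ℝ} {T₁ T₂ : ℝ → ℝ[X] → ℝ[X] → ℝ}
    (h : KMV2000.MomentAsymptotics 1 Δ T₁ T₂) :
    HasShape (fun q _ P Q Δ' ↦ KMV2000.QhPQ q P Q (KMV2000.qhat q ^ Δ')) Δ
      (fun Δ' P Q ↦ KMV2000.secondMomentForm Δ' P Q + T₂ Δ' P Q) := by
  intro P Q hP hQ Δ' h1 h2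
  obtain ⟨C, q₀, hC⟩ := h P Q hP hQ Δ' h1 h2
  exact ⟨C, q₀, fun q _ hq hq₀ hn ↦ (hC q hq hq₀ hn).2⟩

/-- **Refutation shape for the crux itself (oscillation).** If for every `Δ₁ > 1` some `(Δ', P, Q)` with
`Δ' ∈ (1, Δ₁]` has the normalised second moment `Q^h(P,Q)(q̂^{Δ'})/(2ζ(2)² q̂/(Δ'² log² q̂))` fitting two distinct
constants along two unbounded sets of good primes, then `¬ MomentsBeyondDiagonal`. (A tool, not a claim: no
such witness is known; in the route's (A)-world heuristic the resonant Petersson layers would produce one.) -/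
theorem not_momentsBeyondDiagonal_of_two_fits
    (H : ∀ Δ₁ : ℝ, 1 < Δ₁ → ∃ Δ' : ℝ, 1 < Δ' ∧ Δ' ≤ Δ₁ ∧ ∃ P Q : ℝ[X], KMV2000.Admissible P ∧
      KMV2000.IsEvenOrOdd Q ∧ ∃ t' t'' C' C'' : ℝ, t' ≠ t'' ∧
        (∀ q₀ : ℕ, ∃ q : ℕ, ∃ _ : NeZero q, q.Prime ∧ q₀ ≤ q ∧
          (∀ n : ℕ, (n : ℝ) ≠ KMV2000.qhat q ^ Δ') ∧
            ‖KMV2000.QhPQ q P Q (KMV2000.qhat q ^ Δ') -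
                ((2 * riemannZeta 2 ^ 2 *
                    ((KMV2000.qhat q / (Δ' ^ 2 * Real.log (KMV2000.qhat q) ^ 2) : ℝ) : ℂ)) *
                  ((t' : ℝ) : ℂ))‖ ≤
              C' * KMV2000.qhat q * (Real.log (KMV2000.qhat q))⁻¹ ^ 3) ∧
        (∀ q₀ : ℕ, ∃ q : ℕ, ∃ _ : NeZero q, q.Prime ∧ q₀ ≤ q ∧
          (∀ n : ℕ, (n : ℝ) ≠ KMV2000.qhat q ^ Δ') ∧
            ‖KMV2000.QhPQ q P Q (KMV2000.qhat q ^ Δ') -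
                ((2 * riemannZeta 2 ^ 2 *
                    ((KMV2000.qhat q / (Δ' ^ 2 * Real.log (KMV2000.qhat q) ^ 2) : ℝ) : ℂ)) *
                  ((t'' : ℝ) : ℂ))‖ ≤
              C'' * KMV2000.qhat q * (Real.log (KMV2000.qhat q))⁻¹ ^ 3)) :
    ¬ MomentsBeyondDiagonal := by
  rintro ⟨Δ, hΔ, T₁, T₂, h⟩
  obtain ⟨Δ', h1, h2, P, Q, hP, hQ, t', t'', C', C'', hne, hio', hio''⟩ := H Δ hΔ
  exact not_hasShape_of_two_fits hP hQ h1 h2 hne hio' hio'' _ (hasShape_QhPQ_of_momentAsymptotics h)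

/-- **Refutation shape for the crux itself (unboundedness).** -/
theorem not_momentsBeyondDiagonal_of_unbounded
    (H : ∀ Δ₁ : ℝ, 1 < Δ₁ → ∃ Δ' : ℝ, 1 < Δ' ∧ Δ' ≤ Δ₁ ∧ ∃ P Q : ℝ[X], KMV2000.Admissible P ∧
      KMV2000.IsEvenOrOdd Q ∧ ∀ K : ℝ, ∀ q₀ : ℕ, ∃ q : ℕ, ∃ _ : NeZero q, q.Prime ∧ q₀ ≤ q ∧
        (∀ n : ℕ, (n : ℝ) ≠ KMV2000.qhat q ^ Δ') ∧
          K * (KMV2000.qhat q / (Δ' ^ 2 * Real.log (KMV2000.qhat q) ^ 2)) <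
            ‖KMV2000.QhPQ q P Q (KMV2000.qhat q ^ Δ')‖) :
    ¬ MomentsBeyondDiagonal := by
  rintro ⟨Δ, hΔ, T₁, T₂, h⟩
  obtain ⟨Δ', h1, h2, P, Q, hP, hQ, hub⟩ := H Δ hΔ
  exact not_hasShape_of_unbounded hP hQ h1 h2 hub _ (hasShape_QhPQ_of_momentAsymptotics h)

end Summit.Parity.GeneralizedHardyLittlewood.Theorems.PrimeLevelFamEdgeIdeaDeltas.PeterssonLayers

end
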